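import Mathlib

/-!
# Venture HSemireg — W3 SPECIAL FIBRES, theta-null line: the g = 2 anchor of the theta-square identity
# (seat `w3-prym-1` g5, file of record `widen/W3/W3-STEPC-PEN-w3prym1.md` v1.2 §6; companion
# `widen/W3/prym2/g3/CONORMAL-X2.md` §5ter–§5terdecies of seat `w3-prym-2`)

HONEST FRAMING. Lean index of the computation cell `pub-hsemireg`, widening seat `w3-prym-1` (W3 pen).
ELEMENTARY INTEGER ALGEBRA OF ONE QUATERNARY QUADRATIC FORM ONLY: no abelian variety, no theta function and no
semiregularity map is constructed here.  On paper (STEPC-PEN §6) two Poisson summations on the genus-2 Weil locus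
S₂ = {[[a, −½], [−½, −1/(12a)]]} reduce the identity ψ₀(τ_a) = √3 · θ[0;0](0, 3τ_a)² to the equality of the theta
series of the quaternary form `F(u₁,u₂,k₁,k₂) = 2(u₁² + u₁u₂ + u₂²) + 3(k₁u₁ + k₂u₂) + 2(k₁² − k₁k₂ + k₂²)` and of
`A₂ ⊕ A₂`, i.e. of `Q(x₁,x₂) + Q(y₁,y₂)` with `Q(x₁,x₂) = x₁² + x₁x₂ + x₂²`.  The statements proved here are exactly
that `F ∘ E = Q ⊕ Q` for an explicit integer matrix `E` with an explicit integer inverse — so `E` is a bijection of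
ℤ⁴ and the two theta series agree term by term.  Nothing here says that HC, HC_CM or HC_AV holds, or that any object
is semiregular.

CONTENT (all PROVED, 0 sorry), namespace `Summit.Ventures.HSemireg.ThetaSquareG2`:
* `F`, `Q` — the two quadratic forms as integer polynomial functions;
* `E`, `Einv` — the change-of-basis matrix (columns (−1,0,1,0), (−1,1,0,−1), (−1,0,1,1), (−1,1,1,0)) and its inverse;
* `E_mul_Einv`, `Einv_mul_E` — `E` is invertible over ℤ (unimodular);
* `twoGramF`, `twoGramA2A2`, `E_isometry_gram` — `Eᵀ · (2·Gram F) · E = 2·Gram(A₂ ⊕ A₂)`;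
* `F_comp_E` — the polynomial identity `F(E·(x₁,x₂,y₁,y₂)) = Q(x₁,x₂) + Q(y₁,y₂)` for all integers.
-/

namespace Summit.Ventures.HSemireg

namespace ThetaSquareG2

open Matrix

/-- The quaternary form of the Poisson-resummed A₂-twist null at genus 2 (STEPC-PEN §6 (ii)):
`F(u₁,u₂,k₁,k₂) = 2(u₁²+u₁u₂+u₂²) + 3(k₁u₁+k₂u₂) + 2(k₁²−k₁k₂+k₂²)`. -/
def F (u₁ u₂ k₁ k₂ : ℤ) : ℤ :=
  2 * (u₁ ^ 2 + u₁ * u₂ + u₂ ^ 2) + 3 * (k₁ * u₁ + k₂ * u₂) + 2 * (k₁ ^ 2 - k₁ * k₂ + k₂ ^ 2)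

/-- The binary form of the hexagonal lattice A₂: `Q(x₁,x₂) = x₁² + x₁x₂ + x₂²` (so `Σ q^{Q} = a(q)`). -/
def Q (x₁ x₂ : ℤ) : ℤ := x₁ ^ 2 + x₁ * x₂ + x₂ ^ 2

/-- The change-of-basis matrix `E` (columns = the images of the standard basis of `A₂ ⊕ A₂`):
columns (−1,0,1,0), (−1,1,0,−1), (−1,0,1,1), (−1,1,1,0) in the coordinates (u₁,u₂,k₁,k₂). -/
def E : Matrix (Fin 4) (Fin 4) ℤ := !![-1, -1, -1, -1; 0, 1, 0, 1; 1, 0, 1, 1; 0, -1, 1, 0]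

/-- The integer inverse of `E`. -/
def Einv : Matrix (Fin 4) (Fin 4) ℤ := !![0, -1, 1, -1; -1, 0, -1, 0; -1, 0, -1, 1; 1, 1, 1, 0]

/-- `E · E⁻¹ = 1` over ℤ. -/
theorem E_mul_Einv : E * Einv = 1 := by decide

/-- `E⁻¹ · E = 1` over ℤ: `E` is unimodular, hence a bijection of ℤ⁴. -/
theorem Einv_mul_E : Einv * E = 1 := by decide

/-- Twice the Gram matrix of `F` in the coordinates (u₁,u₂,k₁,k₂): `F(v) = ½ vᵀ (twoGramF) v`. -/
def twoGramF : Matrix (Fin 4) (Fin 4) ℤ := !![4, 2, 3, 0; 2, 4, 0, 3; 3, 0, 4, -2; 0, 3, -2, 4]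

/-- Twice the Gram matrix of `Q ⊕ Q` (the root lattice `A₂ ⊕ A₂`). -/
def twoGramA2A2 : Matrix (Fin 4) (Fin 4) ℤ := !![2, 1, 0, 0; 1, 2, 0, 0; 0, 0, 2, 1; 0, 0, 1, 2]

/-- The isometry at the level of Gram matrices: `Eᵀ · (2·Gram F) · E = 2·Gram(A₂ ⊕ A₂)`. -/
theorem E_isometry_gram : Eᵀ * twoGramF * E = twoGramA2A2 := by decide

/-- The isometry as a polynomial identity: substituting `(u₁,u₂,k₁,k₂) = E·(x₁,x₂,y₁,y₂)`, i.e.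
`u₁ = −x₁−x₂−y₁−y₂`, `u₂ = x₂+y₂`, `k₁ = x₁+y₁+y₂`, `k₂ = −x₂+y₁`, turns `F` into `Q(x₁,x₂) + Q(y₁,y₂)`.
Consequently `Σ_{ℤ⁴} q^{F} = (Σ_{ℤ²} q^{Q})² = a(q)²` (STEPC-PEN §6 (iii): `G = a²`, whence `λ₀^{(2)} = √3`). -/
theorem F_comp_E (x₁ x₂ y₁ y₂ : ℤ) :
    F (-x₁ - x₂ - y₁ - y₂) (x₂ + y₂) (x₁ + y₁ + y₂) (-x₂ + y₁) = Q x₁ x₂ + Q y₁ y₂ := by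
  unfold F Q
  ring

end ThetaSquareG2

end Summit.Ventures.HSemireg
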